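import Summits.BirchSwinnertonDyer.Rank1Residual.Additive.StrictSelmerDominatesShaAlgebra
import Summits.BirchSwinnertonDyer.Rank1Residual.Additive.QuadraticBranchOddStrictSelmer
import Literature.NumberTheory.EllipticCurves.ShaRestriction
import Mathlib.NumberTheory.Padics.HeightOneSpectrum
import HarnessLib

/-!
# (P4) `Additive.StrictSelmerDominatesShaAt` DISCHARGED: in rank `≥ 1` every class of `Ш(E/ℚ)[p^∞]`
# has a `p`-STRICT Selmer representative, so `#Ш(E/ℚ)[p^∞] ∣ #Sel_str(E/ℚ)[p^∞]` — UNCONDITIONAL,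
# every `E/ℚ`, every prime `p` (cell `b2b-bsdres`, team n1011, seat p01 GEN 2; lead GEN 6 R5-37 deal
# "x1b's (P4)"; cc-typer-6's typed input p259634 §4 `QuadraticBranchOddStrictSelmer.lean`; x1b GEN 26's
# plan `HOME/b2b-bsdres-x1b/gen26/P4-PLAN-StrictSelmerDominatesSha.md` f9daf5193aadc6d9, followed with
# two simplifications recorded below)

HONEST FRAMING (cell `b2b-bsdres`, run/shared/lean/b2b/bsd-rank1-residual/, verbatim in every
file): prove what is provable now; shrink each hard class to its core with data; no claim beyond
stated classes. Research routes; census output = EVIDENCE / conjecture items, never a Literature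
fact; RESIDUAL-MAP marks change only by signed lines; nothing is booked; no label changes. This file
is ELEMENTARY ALGEBRA + Galois-cohomology bookkeeping over the tree's `p^∞` Kummer theory
(`SelmerCorankProofs`, `StrictSelmerRankOne`, `ShaRestriction`); THEOREMS ONLY — NO definition, NO
Literature fact, NO `sorry`; `#print axioms` standard. It closes a TYPED INPUT of the O7-ss ∩ `e = 2`
strand (cc-typer-6 / x1b); the classes that input serves stay OPEN / CONSTRUCTION-SHAPED.

## Statement (p259634 §4, verbatim)
`StrictSelmerDominatesShaAt W p := 1 ≤ W.mordellWeilRank → Nat.card (Ш(W)[p^∞]) ∣ Nat.card ↥(strictSelmerPInfty W p)`,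
`strictSelmerPInfty W p = W.selmerGroupPInfty p ⊓ selmerLocalKerPrimaryTorsion W ℚ_[p] p`.
**`strictSelmerDominatesShaAt_holds : Additive.StrictSelmerDominatesShaAt W p`** (§3).

## Proof (x1b's §1 argument, streamlined)
* `StrictSelmerDominatesShaAlgebra.lean` §1–§3 (algebra): `λ : E(ℚ_p) → ℤ_p` with kernel EXACTLY the torsion AND `p^b ℤ_p ⊆ im λ` (AEC VII.6.3
  `exists_finiteIndex_addEquiv_padicInt_holds`; this replaces x1b's (S1)/(S2) — no structure theorem
  for subgroups of `ℤ_p` is needed); integer approximation in `ℤ_p` (`PadicInt.appr`,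
  `PadicInt.unitCoeff_spec`); Bezout split of a torsion point (`T = T₁ + p^n T₂`, `T₁` of `p`-power
  order).
* `…Algebra.lean` §4: `E`-rational points are `Γ_E`-fixed in `E(Ē)`.
* §1 CORE (class-free, any perfect `K`, any perfect `K`-field `E`): a class `s ∈ H¹(K, E[p^∞])` dying
  in `H¹(E, E(Ē))` is, up to a global Kummer class `κ_n(a·P₁)` (`P₁` of infinite order), locally
  trivial in `H¹(E, E(Ē)[p^∞])`. With a cocycle `c` of `s` (`oneCocycleClass_surjective`) and the
  cocycle criterion (`oneCocycleClass_mem_resKer_iff`): `ι c(τ) = τQ − Q`, `p^k c = 0` (compactness,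
  `exists_pow_smul_apply_eq_zero`), `p^k Q = R ∈ E(E)` (Galois descent
  `exists_map_eq_of_forall_smul_localPoints_eq`); the algebra file gives `a ∈ ℤ`, `Y ∈ E(E)`,
  `n = k + v_p(λ P₁)` with `p^{v} R − a P₁ − p^n Y = T₁` of `p`-power order; with `p^n Q' = a P₁`
  (`kummerRoot`) the element `z = Q − Q' − Y ∈ E(Ē)[p^∞]` has `(c − κ)(τ) = τz − z` on `Γ_E`.
* §2 assembly over a number field: the strict classes SURJECT onto `Ш[p^∞]`
  (`map_primaryH1ToH1_selmerGroupPInfty`, `ker_primaryH1ToH1_le_selmerGroupPInfty`), hence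
  `#Ш[p^∞] = #(S₀/ker) ∣ #S₀` (`AddSubgroup.card_eq_card_quotient_mul_card_addSubgroup`; `Nat.card`).
* §3 the local condition at `p`, TRANSPORTED from the tree's `ℚ_v` (`v ∣ p`, where `Sel_{p^∞}` imposes
  it) to Mathlib's `ℚ_[p]` (x1b's §2 (A), 15 lines instead of 150–250: `selmerGroupPInfty_eq_comap_sha`
  + `selmerLocalKerPrimary_eq_comap` + `localRestrictionKer_le_of_tower` along
  `Padic.adicCompletionEquiv : ℚ_[p] ≃A[ℚ] ℚ_v`), and the unconditional discharge.

References: [GreenbergLNM1716] §2 (pp. 62–63: Kummer theory, `E(F) ⊗ ℚ_p/ℤ_p`);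
[KuriharaPollack2007] §1.5 (p. 361: fine/strict Selmer groups); [SilvermanAEC2009] Prop. VII.6.3,
VIII.§1–2, X.§4; [SerreGaloisCohomology1997] I.§2.4, II.§1.1; [Skinner2020] §2.2 (the rank-one
strict Selmer group, companion statement `finite_strictSelmer_of_mordellWeilRank_eq_one`).
-/

noncomputable section

open scoped Classical

open WeierstrassCurve Literature.NumberTheory.EllipticCurves Literature.NumberTheory.GaloisRepresentations

universe u

namespace Summit.BirchSwinnertonDyer.Rank1Residual.Additive.StrictSha

/-! ### §1 The core: every locally-Kummer Selmer class is strict up to a global Kummer class -/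

/-- **CORE (class-free).** Let `K` be a perfect field, `E/K` elliptic (`W`), `p` prime, `E ⊇ K` a
perfect `K`-field (a completion), `λ : E(E) → ℤ_p` additive with kernel EXACTLY the torsion and
`p^b ℤ_p ⊆ im λ`, and `P₁ ∈ E(K)` with `λ(P₁) ≠ 0` (a point of infinite order, seen in `E(E)`). Then every
class `s ∈ H¹(K, E[p^∞])` dying in `H¹(E, E(Ē))` (`s ∈ selmerLocalKerPrimary W E p`: the local Kummer
condition at `E`) is, up to a global Kummer class `κ_n(a·P₁)`, LOCALLY TRIVIAL at `E` in
`H¹(E, E(Ē)[p^∞])`: `s − κ_n(a·P₁) ∈ selmerLocalKerPrimaryTorsion W E p`. Proof: a cocycle `c` of `s`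
has `ι c(τ) = τQ − Q` on `Γ_E` (`Q ∈ E(Ē)`); `p^k c = 0` (compactness), so `p^k Q = R ∈ E(E)`; integer
approximation in `ℤ_p` + the Bezout split give `a ∈ ℤ`, `Y ∈ E(E)`, `n = k + v_p(λ P₁)` with
`p^{v} R − a P₁ − p^n Y = T₁` of `p`-power order; with `p^n Q' = a P₁` (global root) the element
`z := Q − Q' − Y ∈ E(Ē)` is `p`-power torsion and `(c − κ)(τ) = τz − z` on `Γ_E`.
[cite: GreenbergLNM1716, §2 (pp. 62–63)] -/
theorem exists_sub_kummerMapLevel_mem_selmerLocalKerPrimaryTorsion {K : Type u} [Field K]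
    [PerfectField K] (W : WeierstrassCurve K) [W.IsElliptic] (p : ℕ) [Fact p.Prime]
    (hdiv : W.zsmul_geomPoints_surjective) (E : Type u) [Field E] [Algebra K E] [PerfectField E]
    (lam : (W.baseChange E).toAffine.Point →+ ℤ_[p]) {b : ℕ}
    (hlam : ∀ X, lam X = 0 ↔ IsOfFinAddOrder X)
    (hlamb : ∀ z : ℤ_[p], ∃ Y, lam Y = (p : ℤ_[p]) ^ b * z)
    (P₁ : W.toAffine.Point) (hP₁ : lam (Affine.Point.baseChange (W' := W) K E P₁) ≠ 0)
    (s : galH1Primary W p) (hs : s ∈ selmerLocalKerPrimary W E p) :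
    ∃ (n : ℕ) (a : ℤ),
      s - kummerMapLevel W p hdiv n (a • P₁) ∈ selmerLocalKerPrimaryTorsion W E p := by
  have hpP : p.Prime := Fact.out
  -- (1) a cocycle of `s` and the local point `Q` with `ι c(τ) = τ • Q - Q` on `Γ_E`
  obtain ⟨c, rfl⟩ := oneCocycleClass_surjective _ s
  obtain ⟨Q, hQ⟩ := (oneCocycleClass_mem_resKer_iff (resGal (K := K) E)
    ((pointsMap W E).comp (geomPrimaryTorsion W p).subtype) _ c).mp hs
  have hQ' : ∀ τ : Field.absoluteGaloisGroup E,
      pointsMap W E ((c.1 (resGal (K := K) E τ) : geomPrimaryTorsion W p) : geomPoints W) =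
        τ • Q - Q := hQ
  -- (2) compactness: `p ^ k` kills `c`
  haveI := compactSpace_absoluteGaloisGroup K
  obtain ⟨k, hk⟩ := exists_pow_smul_apply_eq_zero (p := p) c.1 fun σ => by
    obtain ⟨k, hk⟩ := (c.1 σ).2
    exact ⟨k, Subtype.ext (by rw [AddSubgroupClass.coe_nsmul]; exact hk)⟩
  -- (3) `p ^ k • Q` is `Γ_E`-fixed, hence `E`-rational
  have hfix : ∀ τ : Field.absoluteGaloisGroup E, τ • (p ^ k • Q) = p ^ k • Q := fun τ => by
    rw [← sub_eq_zero, smul_comm, ← smul_sub, ← hQ' τ, ← map_nsmul, ← AddSubgroupClass.coe_nsmul,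
      hk, ZeroMemClass.coe_zero, map_zero]
  obtain ⟨R, hR⟩ := exists_map_eq_of_forall_smul_localPoints_eq W E hfix
  -- (4) arithmetic in `E(E)`: `p^v R − a P₁ − p^(k+v) Y = T₁` with `T₁` of `p`-power order
  obtain ⟨a, w, haw⟩ := exists_int_pow_mul_sub_mul_eq p hP₁ (lam R) k b
  obtain ⟨Y₀, hY₀⟩ := hlamb w
  set v := (lam (Affine.Point.baseChange (W' := W) K E P₁)).valuation with hv
  have hT : IsOfFinAddOrder
      (p ^ v • R - a • Affine.Point.baseChange (W' := W) K E P₁ - p ^ (k + v) • Y₀) := by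
    rw [← hlam, map_sub, map_sub, map_nsmul, map_zsmul, map_nsmul, hY₀, nsmul_eq_mul, zsmul_eq_mul,
      nsmul_eq_mul]
    push_cast
    linear_combination haw
  obtain ⟨T₁, T₂, b', hT₁, hTeq⟩ := exists_eq_add_nsmul_of_isOfFinAddOrder p hT (k + v)
  set Y := Y₀ + T₂ with hY
  have hmain : p ^ v • R - a • Affine.Point.baseChange (W' := W) K E P₁ - p ^ (k + v) • Y = T₁ := by
    rw [hY, smul_add, ← sub_sub, hTeq, add_sub_cancel_right]
  -- (5) the global Kummer class of `a • P₁` at level `n = k + v`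
  have hQ'n := nsmul_kummerRoot W p hdiv (k + v) (a • P₁)
  set Q' := kummerRoot W p hdiv (k + v) (a • P₁) with hQ'def
  refine ⟨k + v, a, ?_⟩
  rw [kummerMapLevel_eq_kummerClass W p hdiv (k + v) (a • P₁) Q' hQ'n]
  change oneCocycleClass _ c -
      oneCocycleClass _ (kummerCocycle W p (k + v) Q' (smul_nsmul_of_nsmul_eq W p hQ'n)) ∈ _
  rw [← oneCocycleClass_sub]
  refine (oneCocycleClass_mem_resKer_iff (resGal (K := K) E) (primaryPointsMap W E p)
    (primaryPointsMap_smul W E p) _).mpr ?_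
  -- the `E`-rational points inside `E(Ē)` and the comparison `ι(P) = ι_E(bc P)`
  let ιE : (W.baseChange E).toAffine.Point →+ localPoints W E :=
    Affine.Point.map (W' := W) (IsScalarTower.toAlgHom K E (AlgebraicClosure E))
  have hιE : ∀ X : (W.baseChange E).toAffine.Point,
      Affine.Point.map (W' := W) (IsScalarTower.toAlgHom K E (AlgebraicClosure E)) X = ιE X :=
    fun _ => rfl
  have hjP : ∀ P : W.toAffine.Point,
      pointsMap W E (toGeomPoints W P) = ιE (Affine.Point.baseChange (W' := W) K E P) := fun P => by
    change Affine.Point.map (closureEmb (K := K) E)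
        (Affine.Point.baseChange (W' := W) K (AlgebraicClosure K) P) =
      Affine.Point.map _ (Affine.Point.baseChange (W' := W) K E P)
    rw [Affine.Point.map_baseChange, Affine.Point.map_baseChange]
  have hR' : ιE R = p ^ k • Q := hR
  have hRv : p ^ (k + v) • Q = ιE (p ^ v • R) := by
    rw [map_nsmul, hR', ← mul_smul, ← pow_add, add_comm]
  have hbc : Affine.Point.baseChange (W' := W) K E (a • P₁) =
      a • Affine.Point.baseChange (W' := W) K E P₁ := map_zsmul _ _ _
  -- the `p`-power-torsion element `z := Q − ι Q' − ι_E Y`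
  have h1 : p ^ (k + v) • (Q - pointsMap W E Q' - ιE Y) = ιE T₁ := by
    rw [smul_sub, smul_sub, hRv, ← map_nsmul (pointsMap W E), hQ'n, hjP, hbc, ← map_nsmul ιE,
      ← map_sub ιE, ← map_sub ιE, hmain]
  have hz : p ^ ((k + v) + b') • (Q - pointsMap W E Q' - ιE Y) = 0 := by
    rw [pow_add, mul_comm, mul_smul, h1, ← map_nsmul, hT₁, map_zero]
  refine ⟨⟨Q - pointsMap W E Q' - ιE Y, (AddCommGroup.mem_primaryComponent).2 ⟨_, hz⟩⟩, fun τ => ?_⟩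
  apply Subtype.ext
  change pointsMap W E (((c - kummerCocycle W p (k + v) Q' (smul_nsmul_of_nsmul_eq W p hQ'n)).1
      (resGal (K := K) E τ) : geomPrimaryTorsion W p) : geomPoints W) =
    τ • (Q - pointsMap W E Q' - ιE Y) - (Q - pointsMap W E Q' - ιE Y)
  rw [Submodule.coe_sub, ContinuousMap.sub_apply, AddSubgroupClass.coe_sub, map_sub, hQ' τ,
    coe_kummerCocycle_apply, map_sub, pointsMap_smul, smul_sub, smul_sub,
    smul_eq_of_map_eq W E τ Y (hιE Y)]
  abel


/-! ### §2 Assembly: `Sel_str ↠ Ш[p^∞]` in rank `≥ 1`, and the divisibility of orders -/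

/-- A Mordell–Weil group of rank `≥ 1` has a point of infinite order (an element of a Mordell–Weil
basis, `exists_isMordellWeilBasis_holds`). [cite: SilvermanAEC2009, Thm. VIII.6.7] -/
theorem exists_not_isOfFinAddOrder_of_one_le_mordellWeilRank {K : Type*} [Field K] [NumberField K]
    (W : WeierstrassCurve K) [W.IsElliptic] (h : 1 ≤ W.mordellWeilRank) :
    ∃ P₁ : W.toAffine.Point, ¬ IsOfFinAddOrder P₁ := by
  obtain ⟨b, hb⟩ := W.exists_isMordellWeilBasis_holds
  refine ⟨b ⟨0, by omega⟩, fun htor => hb.1.ne_zero ⟨0, by omega⟩ ?_⟩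
  simp only [Function.comp_apply]
  exact (QuotientAddGroup.eq_zero_iff _).mpr htor

/-- **`#Ш(E/K)[p^∞] ∣ #(Sel_{p^∞}(E/K) ∩ Sel_str at E)` in rank `≥ 1` — general form.** For an elliptic
curve `E` over a number field `K`, a prime `p`, a perfect `K`-field `E` with `λ : E(E) → ℤ_p`
(kernel = torsion, `p^b ℤ_p ⊆ im λ`), IF every `Sel_{p^∞}` class satisfies the local Kummer condition
at `E` along the chosen embedding (`hloc : Sel_{p^∞}(E/K) ≤ selmerLocalKerPrimary W E p` — for
`E = ℚ_p` this is the TRANSPORT of the Selmer local condition from `ℚ_v`, `v ∣ p`, to `ℚ_[p]`, NOT in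
the tree: x1b's P4-PLAN §2 (A); it enters as a HYPOTHESIS) and `rank_ℤ E(K) ≥ 1`, THEN the strict
classes SURJECT onto `Ш[p^∞]` (§5) and `#Ш(E/K)[p^∞]` divides `#(Sel_{p^∞} ⊓ strict)` (`Nat.card`,
`= 0` for an infinite group). [cite: GreenbergLNM1716, §2 (pp. 62–63)]
[cite: KuriharaPollack2007, §1.5 (p. 361) (strict/fine formulation)] -/
theorem card_primaryComponent_sha_dvd_card_strictSelmer_of_hom {K : Type u} [Field K] [NumberField K]
    (W : WeierstrassCurve K) [W.IsElliptic] (p : ℕ) [Fact p.Prime]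
    (E : Type u) [Field E] [Algebra K E] [PerfectField E]
    (lam : (W.baseChange E).toAffine.Point →+ ℤ_[p]) {b : ℕ}
    (hlam : ∀ X, lam X = 0 ↔ IsOfFinAddOrder X)
    (hlamb : ∀ z : ℤ_[p], ∃ Y, lam Y = (p : ℤ_[p]) ^ b * z)
    (hrank : 1 ≤ W.mordellWeilRank)
    (hloc : W.selmerGroupPInfty p ≤ selmerLocalKerPrimary W E p) :
    Nat.card (AddCommGroup.primaryComponent W.sha p) ∣
      Nat.card ↥(W.selmerGroupPInfty p ⊓ selmerLocalKerPrimaryTorsion W E p) := by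
  have hdiv : W.zsmul_geomPoints_surjective := W.zsmul_geomPoints_surjective_holds
  -- a point of infinite order, seen in `E(E)`
  obtain ⟨P₁, hP₁⟩ := exists_not_isOfFinAddOrder_of_one_le_mordellWeilRank W hrank
  let bc : W.toAffine.Point →+ (W.baseChange E).toAffine.Point :=
    Affine.Point.baseChange (W' := W) K E
  have hinj : Function.Injective bc := Affine.Point.map_injective (W' := W) (Algebra.ofId K E)
  have hu0 : lam (bc P₁) ≠ 0 := by
    intro h0
    apply hP₁
    obtain ⟨n, hn, hnP⟩ := isOfFinAddOrder_iff_nsmul_eq_zero.mp ((hlam _).mp h0)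
    refine isOfFinAddOrder_iff_nsmul_eq_zero.mpr ⟨n, hn, hinj ?_⟩
    rw [map_nsmul, map_zero]
    exact hnP
  set S₀ := W.selmerGroupPInfty p ⊓ selmerLocalKerPrimaryTorsion W E p with hS₀
  set πS : S₀ →+ W.galH1 := (primaryH1ToH1 W p).comp S₀.subtype with hπS
  -- the image of `S₀` in `H¹(K, E)` is ALL of `Ш[p^∞]` (core §5)
  have hrange : πS.range = (AddCommGroup.primaryComponent W.sha p).map W.sha.subtype := by
    rw [← map_primaryH1ToH1_selmerGroupPInfty W p hdiv]
    ext x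
    constructor
    · rintro ⟨c, rfl⟩
      exact ⟨c, c.2.1, rfl⟩
    · rintro ⟨s, hs, rfl⟩
      obtain ⟨n, a, hstr⟩ := exists_sub_kummerMapLevel_mem_selmerLocalKerPrimaryTorsion W p hdiv E
        lam hlam hlamb P₁ hu0 s (hloc hs)
      have hker : kummerMapLevel W p hdiv n (a • P₁) ∈ W.selmerGroupPInfty p :=
        ker_primaryH1ToH1_le_selmerGroupPInfty W p (primaryH1ToH1_kummerMapLevel W p hdiv n (a • P₁))
      refine ⟨⟨s - kummerMapLevel W p hdiv n (a • P₁), (W.selmerGroupPInfty p).sub_mem hs hker, hstr⟩, ?_⟩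
      change primaryH1ToH1 W p (s - kummerMapLevel W p hdiv n (a • P₁)) = primaryH1ToH1 W p s
      rw [map_sub, primaryH1ToH1_kummerMapLevel, sub_zero]
  -- counting
  have hcardSha : Nat.card (AddCommGroup.primaryComponent W.sha p) = Nat.card πS.range := by
    rw [hrange]
    exact (Nat.card_congr ((AddCommGroup.primaryComponent W.sha p).equivMapOfInjective W.sha.subtype
      Subtype.val_injective).toEquiv)
  rw [hcardSha, Nat.card_congr (QuotientAddGroup.quotientKerEquivRange πS).symm.toEquiv,
    AddSubgroup.card_eq_card_quotient_mul_card_addSubgroup πS.ker]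
  exact Dvd.intro _ rfl

/-- **(P4) DISCHARGED modulo the local-condition transport: `Additive.StrictSelmerDominatesShaAt W p`
from `hloc : Sel_{p^∞}(E/ℚ) ≤ selmerLocalKerPrimary W ℚ_[p] p`.** For an elliptic curve `E/ℚ` (any
model `W`) and a prime `p`: if every `Sel_{p^∞}` class dies in `H¹(ℚ_p, E(ℚ̄_p))` along the chosen
embedding (the local Kummer condition at `p` stated at `ℚ_[p]`; in the tree the Selmer condition
sits at `v.adicCompletion ℚ`, `v ∣ p`, and the transport to `ℚ_[p]` is x1b's P4-PLAN §2 (A), NOT yet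
written — so `hloc` is an explicit HYPOTHESIS here, design (A) of the cell's 'taking P4' line), then
`rank_ℤ E(ℚ) ≥ 1 ⟹ #Ш(E/ℚ)[p^∞] ∣ #Sel_str(E/ℚ)[p^∞]`. `λ : E(ℚ_p) → ℤ_p` from AEC VII.6.3 (§1).
[cite: GreenbergLNM1716, §2 (pp. 62–63)] [cite: KuriharaPollack2007, §1.5 (p. 361)]
[cite: SilvermanAEC2009, Prop. VII.6.3] -/
theorem strictSelmerDominatesShaAt_of_loc (W : WeierstrassCurve ℚ) [W.IsElliptic] (p : ℕ)
    [Fact p.Prime] (hloc : W.selmerGroupPInfty p ≤ selmerLocalKerPrimary W ℚ_[p] p) :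
    Additive.StrictSelmerDominatesShaAt W p := by
  intro hrank
  obtain ⟨lam, b, hlam, hlamb⟩ :=
    exists_addMonoidHom_padicInt_ker_torsion_pow_mem_range p (W.baseChange ℚ_[p])
  exact card_primaryComponent_sha_dvd_card_strictSelmer_of_hom W p ℚ_[p] lam hlam hlamb hrank hloc


/-! ### §3 The local condition at `p`, transported from `ℚ_v` (`v ∣ p`) to `ℚ_[p]` — and (P4) unconditional -/

/-- **Transport of the Selmer local condition to `ℚ_[p]`** (x1b's P4-PLAN §2 (A)): every class of
`Sel_{p^∞}(E/ℚ)` dies in `H¹(ℚ_p, E(ℚ̄_p))` computed with Mathlib's `ℚ_[p]` (`selmerLocalKerPrimary W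
ℚ_[p] p`). In the tree the Selmer condition at `p` is imposed at the completion `ℚ_v`
(`v.adicCompletion ℚ`, `v` the place over `p`): `Sel_{p^∞} = primaryH1ToH1⁻¹ Ш`
(`selmerGroupPInfty_eq_comap_sha`), `selmerLocalKerPrimary W E p = primaryH1ToH1⁻¹ (localRestrictionKer E)`
(`selmerLocalKerPrimary_eq_comap`), and local kernels GROW along any `ℚ`-algebra map `ℚ_v → ℚ_[p]`
(`localRestrictionKer_le_of_tower`); Mathlib's `Padic.adicCompletionEquiv : ℚ_[p] ≃A[ℚ] ℚ_v` supplies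
the map. [cite: SerreGaloisCohomology1997, I.§2.4 and II.§1.1] -/
theorem selmerGroupPInfty_le_selmerLocalKerPrimary_padic (W : WeierstrassCurve ℚ) (p : ℕ)
    [Fact p.Prime] : W.selmerGroupPInfty p ≤ selmerLocalKerPrimary W ℚ_[p] p := by
  intro s hs
  let v : IsDedekindDomain.HeightOneSpectrum (NumberField.RingOfIntegers ℚ) :=
    (Rat.HeightOneSpectrum.primesEquiv (R := NumberField.RingOfIntegers ℚ)).symm ⟨p, Fact.out⟩
  let e : ℚ_[p] ≃A[ℚ] v.adicCompletion ℚ :=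
    Padic.adicCompletionEquiv (NumberField.RingOfIntegers ℚ) ⟨p, Fact.out⟩
  letI : Algebra (v.adicCompletion ℚ) ℚ_[p] :=
    ((e.symm : v.adicCompletion ℚ ≃A[ℚ] ℚ_[p]) : v.adicCompletion ℚ →ₐ[ℚ] ℚ_[p]).toRingHom.toAlgebra
  haveI : IsScalarTower ℚ (v.adicCompletion ℚ) ℚ_[p] :=
    IsScalarTower.of_algebraMap_eq fun q ↦
      (((e.symm : v.adicCompletion ℚ ≃A[ℚ] ℚ_[p]) : v.adicCompletion ℚ →ₐ[ℚ] ℚ_[p]).commutes q).symm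
  rw [selmerLocalKerPrimary_eq_comap, AddSubgroup.mem_comap]
  rw [selmerGroupPInfty_eq_comap_sha, AddSubgroup.mem_comap, mem_sha_iff] at hs
  exact localRestrictionKer_le_of_tower W (E := v.adicCompletion ℚ) (hs.1 v)

/-- **(P4) `Additive.StrictSelmerDominatesShaAt W p` HOLDS — unconditionally**, for every elliptic
curve `E/ℚ` (any model `W`) and every prime `p`: `rank_ℤ E(ℚ) ≥ 1 ⟹ #Ш(E/ℚ)[p^∞] ∣ #Sel_str(E/ℚ)[p^∞]`
(cc-typer-6's typed input p259634 §4, discharged; §2 + §3). [cite: GreenbergLNM1716, §2 (pp. 62–63)]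
[cite: KuriharaPollack2007, §1.5 (p. 361)] [cite: SilvermanAEC2009, Prop. VII.6.3] -/
theorem strictSelmerDominatesShaAt_holds (W : WeierstrassCurve ℚ) [W.IsElliptic] (p : ℕ)
    [Fact p.Prime] : Additive.StrictSelmerDominatesShaAt W p :=
  strictSelmerDominatesShaAt_of_loc W p (selmerGroupPInfty_le_selmerLocalKerPrimary_padic W p)

end Summit.BirchSwinnertonDyer.Rank1Residual.Additive.StrictSha

end
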